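import Literature.IUT.LogThetaLattice.PacketWeightsCapsuleAdditivity
import Literature.IUT.LogVolume.TensorPacketCapsuleRegion
import HarnessLib

/-!
# [IUTchIII] Prop. 3.9 (i)/(iii) for capsules at the REAL tensor packets: the Rmk-3.1.1-weighted log-volume
# of a capsule region `⊗_α 𝔞_α` is the SUM over the labels of the single-label log-volumes (proof-only)

S. Mochizuki, *Inter-universal Teichmüller theory III*, kurims manuscript (May 2020), Remark 3.1.1 (ii) p. 94
(the normalized weights on the portions `⊗_α K_{v_α}` of `log(^A𝓕_{v_ℚ}) = ⊗_{α∈A} ⊕_{v|v_ℚ} log(^α𝓕_v) =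
⊕_{{v_α}} ⊗_α K_{v_α}`), (iv) p. 97, Proposition 3.9 (i) p. 115 (`μ^log_{A,v_ℚ}`, packet-normalised) and (iii)
p. 117 (global log-volume / degree "relative to a suitable normalization"). [claim: Mochizuki2012, status:
disputed]

THE TWO HALVES ALREADY IN THE TREE. (1) abc-iut-w4-d035's `sum_packetWeightTensor_mul_tensorDetChange`
(`PacketWeightsCapsuleAdditivity.lean`, finding d035-F1): IF the Haar log-volume change on the portion
`⊗_α K_{wA α}` contributed by a capsule region is `Σ_α (Π_{β≠α} n_{wA β}) · t α (wA α)` (abstract reals `t`),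
THEN the `packetWeightTensor`-weighted sum over the portions is `Σ_α Σ_w packetWeight w · t α w` — additive
over the labels, in the single-label unit. (2) abc-iut-w5-d178's `tensorLogVolume_purePacket_mul_normalizedPacket`
(`Literature/IUT/LogVolume/TensorPacketCapsuleRegion.lean`, over campaign-S's REAL packet `⊗_{ℚ_p} k_i` with
Mochizuki's `μ^log = tensorLogVolume`, normalised by `dim_{ℚ_p}`): the capsule region `(⊗_α x_α)·(R_I)^∼` HAS
`μ^log = Σ_α log ‖x_α‖`.

THIS FILE composes them: for fields `k_w` (`w ∈ W`, the places over `v_ℚ = p`) of the cell's MLF class with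
`n_w = degKF w · degF w`, units `x_{α,w} ∈ k_w^×`, and the portions `M_{wA} = ⊗_α k_{wA α}` (`wA : A → W`) with
`(R_I)^∼` compact,

* `prod_deg_mul_tensorLogVolume_capsule` — the dimension-rescaled ("plain Haar") log-volume of the capsule
  region in the portion `wA` is `Σ_α (Π_{β≠α} n_{wA β}) · (n_{wA α} · log ‖x_{α,wA α}‖)`: the REAL instance of
  d035's abstract `t α w := n_w · log ‖x_{α,w}‖`;
* **`weightedCapsuleLogVolume_eq_sum_labels`** — hence the Rmk 3.1.1 (ii)-weighted `A`-capsule log-volume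
  `Σ_{wA} packetWeightTensor(wA) · (Π_α n_{wA α}) · μ^log_{M_{wA}}((⊗_α x_{α,wA α})·(R_I)^∼)` EQUALS
  `Σ_α Σ_w packetWeight(w) · n_w · log ‖x_{α,w}‖` — the sum over `α ∈ A` of the single-label weighted
  log-volumes of the ideal regions `𝔞_α = ∏_w x_{α,w}𝒪_w` (for which `n_w · log ‖x_{α,w}‖` is the Haar
  log-volume of `x_{α,w}𝒪_w` relative to `𝒪_w`, [AbsTopIII] Prop. 5.7 (i)(b)); and `…_single` — one label
  only recovers `packetWeight`-normalisation `Σ_w packetWeight(w)·n_w·log‖x_w‖` (Prop. 3.9 (i) `μ^log_{α,v_ℚ}`).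

So abc-iut-L6-d3's divisor-level `capsuleLogVolume₁` (additive over labels, one unit for all `A`,
`PacketLogVolumesCapsulesNormalized.lean`) is the value of the printed weighted log-volume on capsule regions
of the REAL tensor packets — closing residual R-iii-tensor of plan/L6/SUBDAG-IUTchIII-Prop-39.md up to the
global `v_ℚ`-bookkeeping already done at divisor level (`prop39iii_*_capsuleModel₁`). Classical; proof-only;
no side taken on [IUTchIII] Cor. 3.12; typed ≠ endorsed. [cite: DupuyHilado2025, §3.7]
-/

noncomputable section

namespace Literature.IUT.LogThetaLattice

open Literature.IUT.LogVolume Finset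
open scoped NNReal ENNReal Pointwise TensorProduct NormedField

variable (p : ℕ) [Fact p.Prime]
variable {W : Type} [Fintype W] [Nonempty W]
variable (k : W → Type) [∀ w, NontriviallyNormedField (k w)] [∀ w, NormedAlgebra ℚ_[p] (k w)]
  [∀ w, IsUltrametricDist (k w)] [∀ w, ProperSpace (k w)]
variable {A : Type} [Fintype A] [DecidableEq A] [Nonempty A]

omit [Fintype W] [Nonempty W] in
/-- **The REAL instance of d035's abstract `t`.** In the portion `M_{wA} = ⊗_α k_{wA α}` (campaign-S
`PacketAlgebra p (k ∘ wA)`), the capsule region `(⊗_α x_{α,wA α})·(R_I)^∼` has dimension-rescaled log-volume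
`(Π_α n_{wA α}) · μ^log = Σ_α (Π_{β≠α} n_{wA β}) · (n_{wA α} · log ‖x_{α,wA α}‖)` — by
`tensorLogVolume_purePacket_mul_normalizedPacket` (`μ^log = Σ_α log ‖x_α‖`) and `Π_β n_β = (Π_{β≠α} n_β)·n_α`.
[claim: Mochizuki2012, status: disputed] -/
theorem prod_deg_mul_tensorLogVolume_capsule (n : W → ℝ) (wA : A → W) (x : A → ∀ w, (k w)ˣ)
    (hc : IsCompact (normalizedPacket p (fun α => k (wA α)) : Set (PacketAlgebra p (fun α => k (wA α))))) :
    (∏ α, n (wA α)) *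
        tensorLogVolume p (fun α => k (wA α))
          ((fun y => purePacket p (fun α => k (wA α)) (fun α => (x α (wA α) : k (wA α))) * y) ''
            (normalizedPacket p (fun α => k (wA α)) : Set (PacketAlgebra p (fun α => k (wA α))))) =
      ∑ α, (∏ β ∈ univ.erase α, n (wA β)) * (n (wA α) * Real.log ‖(x α (wA α) : k (wA α))‖) := by
  rw [tensorLogVolume_purePacket_mul_normalizedPacket p (fun α => k (wA α)) (fun α => x α (wA α)) hc,
    Finset.mul_sum]
  refine Finset.sum_congr rfl fun α _ => ?_
  rw [← mul_assoc, Finset.prod_erase_mul univ (fun β => n (wA β)) (Finset.mem_univ α)]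

/-- **[IUTchIII] Prop. 3.9 (i)/(iii) label-additivity at the REAL tensor packets (Rmk 3.1.1 (ii) weights).**
For units `x_{α,w} ∈ k_w^×` and the portions `M_{wA} = ⊗_α k_{wA α}` with `(R_I)^∼` compact: the
`packetWeightTensor`-weighted sum over all portions `wA : A → W` of the dimension-rescaled log-volumes of the
capsule regions `(⊗_α x_{α,wA α})·(R_I)^∼` equals `Σ_α Σ_w packetWeight(w) · n_w · log ‖x_{α,w}‖`
(`n_w = degKF w · degF w = [k_w : ℚ_p]`) — the SUM over the labels of the single-label printed log-volumes of
the ideal regions `𝔞_α = ∏_w x_{α,w}𝒪_w`, one unit for every capsule size (d035-F1 / abc-iut-L6-d3's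
`capsuleLogVolume₁`, now a theorem of the real packets). [claim: Mochizuki2012, status: disputed] -/
theorem weightedCapsuleLogVolume_eq_sum_labels (degF degKF : W → ℕ+) (x : A → ∀ w, (k w)ˣ)
    (hc : ∀ wA : A → W,
      IsCompact (normalizedPacket p (fun α => k (wA α)) : Set (PacketAlgebra p (fun α => k (wA α))))) :
    ∑ wA : A → W, packetWeightTensor degF degKF wA *
        ((∏ α, ((degKF (wA α) : ℝ) * (degF (wA α) : ℝ))) *
          tensorLogVolume p (fun α => k (wA α))
            ((fun y => purePacket p (fun α => k (wA α)) (fun α => (x α (wA α) : k (wA α))) * y) ''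
              (normalizedPacket p (fun α => k (wA α)) : Set (PacketAlgebra p (fun α => k (wA α)))))) =
      ∑ α, ∑ w, packetWeight degF degKF w *
        (((degKF w : ℝ) * (degF w : ℝ)) * Real.log ‖(x α w : k w)‖) := by
  have h : ∀ wA : A → W,
      (∏ α, ((degKF (wA α) : ℝ) * (degF (wA α) : ℝ))) *
          tensorLogVolume p (fun α => k (wA α))
            ((fun y => purePacket p (fun α => k (wA α)) (fun α => (x α (wA α) : k (wA α))) * y) ''
              (normalizedPacket p (fun α => k (wA α)) : Set (PacketAlgebra p (fun α => k (wA α))))) =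
        ∑ α, (∏ β ∈ univ.erase α, ((degKF (wA β) : ℝ) * (degF (wA β) : ℝ))) *
          (((degKF (wA α) : ℝ) * (degF (wA α) : ℝ)) * Real.log ‖(x α (wA α) : k (wA α))‖) :=
    fun wA => prod_deg_mul_tensorLogVolume_capsule p k (fun w => ((degKF w : ℝ) * (degF w : ℝ))) wA x (hc wA)
  simp_rw [h]
  exact sum_packetWeightTensor_mul_tensorDetChange degF degKF
    (fun α w => ((degKF w : ℝ) * (degF w : ℝ)) * Real.log ‖(x α w : k w)‖)

end Literature.IUT.LogThetaLattice

end
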